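import Mathlib.Analysis.Calculus.Deriv.Basic
import Mathlib.Analysis.SpecialFunctions.Pow.Real
import Mathlib.Topology.Algebra.InfiniteSum.Basic
import Mathlib.Topology.Order.Basic
import HarnessLib

/-!
# The σ–ε mixed-correlator bootstrap system in three dimensions (typed axioms)

Statement-level typing of the hypotheses under which the 3D Ising "island" numerics are derived
(Kos–Poland–Simmons-Duffin, JHEP 11 (2014) 109, §3.2–3.3; Kos–Poland–Simmons-Duffin–Vichi,
JHEP 08 (2016) 036, §2.1), so that a *certified* dual-functional exclusion can be stated as a
theorem `IsingEnclosure W R` about exactly these hypotheses and nothing stronger. Nothing here is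
proved about the 3D Ising model on `ℤ³`; nothing here constructs a CFT.

* `IsConformalBlock3D Δ₁₂ Δ₃₄ Δ ℓ g` — `g` is *the* genuine three-dimensional scalar conformal
  block `g^{Δ₁₂,Δ₃₄}_{Δ,ℓ}(z, z̄)` of Dolan–Osborn, characterised (not merely normalised) by:
  (i) on the real square `z, z̄ ∈ (0,1)`, `g(z,z̄) = (z z̄)^{(Δ-ℓ)/2} K(z,z̄)` with `K` a symmetric
  double power series `∑ k_{mn} z^m z̄^n` absolutely convergent on the open unit bidisk;
  (ii) the Dolan–Osborn boundary condition `g → c_ℓ z^{(Δ+ℓ)/2} z̄^{(Δ-ℓ)/2}` as `z, z̄ → 0` with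
  `z̄ → 0` first, i.e. `K(z, 0) = z^ℓ (1 + O(z))` (normalisation `c_ℓ = 1` of Dolan–Osborn 2011,
  eq. (2.8)–(2.9); the same constant for every `(Δ₁₂, Δ₃₄)`, which is all the sum rules need);
  (iii) the quadratic Casimir equation `Δ^{(ε)}(a,b) g = c_{λ₁λ₂} g` of Dolan–Osborn 2011,
  eq. (2.10)–(2.12), in the form multiplied by `(z - z̄)`, with `a = -Δ₁₂/2`, `b = Δ₃₄/2`,
  `ε = (d-2)/2 = 1/2` and `c = ½[Δ(Δ-3) + ℓ(ℓ+1)]`. The operator `D_x(a,b)` and the eigenvalue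
  are `dolanOsbornD` and `casimirEigenvalue3D`. The power-series ansatz (i) is the statement
  that the block is a sum over descendants (Hogervorst–Rychkov 2013, §2–§4: `g = ∑_{n,j} B_{n,j}
  r^{Δ+n} P_j(η)` with `j ≤ n + ℓ`, `j ≡ n + ℓ (mod 2)`, hence `r^{n+ℓ} P_j(η)` a polynomial in
  `ρ, ρ̄` and `g = (ρρ̄)^{(Δ-ℓ)/2} × (power series)`, transported to `z` by the analytic map
  `ρ = z/(1+√(1-z))²`). The Casimir recursion is triangular in the total degree of `K` and its
  pivot at level `n ≥ 1`, angular index `j`, is `C_{Δ+n,j} - C_{Δ,ℓ} = 2nΔ + n(n-3) + j(j+1) - ℓ(ℓ+1)`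
  (Hogervorst–Rychkov 2013, §3–4: the factor on the left of their recursion for `B_{n,j}`), so for
  `Δ` above the unitarity bound and OFF the *accidental-degeneracy set* `accidentalDegeneracy3D`
  (the finitely many rational `Δ` per spin where some pivot vanishes, i.e. where another pair
  `(Δ+n, j)` has the same Casimir eigenvalue and `g_{Δ,ℓ} + C (z z̄)^{(n+ℓ-j)/2} g_{Δ+n,j}` also
  satisfies (i)–(iii) for every `C`: e.g. `(Δ,ℓ) = (7,3)` with `(8,0)`, `(11/2,4)` with `(15/2,0)`,
  `(10,4)` with `(11,1)`; empty for `ℓ ≤ 2`) the recursion determines `k_{mn}` uniquely from (ii)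
  (poles of the block sit at or below the bound: Kos–Poland–Simmons-Duffin 2014, §4, Table 1);
  that uniqueness is NOT proved here — a certified evaluator must prove that its series satisfies
  this predicate and that the predicate has at most one solution on the parameter set it covers
  (REFEREE.md T1, F20). Exactly at the unitarity bound the recursion is degenerate too (conserved
  currents: the equal-dimension block is fixed only up to an admixture of the null-descendant
  block) or has no solution (the free-scalar point `Δ = 1/2, ℓ = 0`, and unequal dimensions), so
  `IsConformalBlock3D` defines the block at the bound AND on the accidental-degeneracy set as the
  pointwise limit `Δ' ↓ Δ` of the generic blocks `IsConformalBlock3DAbove` — the standard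
  meromorphic-continuation definition (Kos–Poland–Simmons-Duffin 2014, §4); the block is analytic
  in `Δ` at every accidental-degeneracy point, so the limit is the genuine block there.
* `SigmaEpsilonData` — the data the semidefinite programme sees: external dimensions
  `Δ_σ, Δ_ε`; the `ℤ₂`-even non-identity operators `𝒪⁺` of `σ×σ` and `ε×ε` with dimensions,
  spins, real OPE coefficients `λ_{σσ𝒪}, λ_{εε𝒪}` and block functions `g^{0,0}`; the `ℤ₂`-odd
  operators `𝒪⁻` of `σ×ε` with `λ_{σε𝒪}` and the two block functions `g^{Δ_σε,Δ_σε}`,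
  `g^{-Δ_σε,Δ_σε}` (`Δ_σε = Δ_σ - Δ_ε`) that `⟨σεσε⟩` and `⟨εσσε⟩` need. The identity is not an
  index: it enters the sum rules explicitly with `λ_{σσ𝟙} = λ_{εε𝟙} = 1`, block `1`.
* The axioms (one predicate each, conjoined in `SatisfiesBootstrapAxioms`):
  A2 `HasGenuineBlocks` (every block function is a genuine block, `IsConformalBlock3D`);
  A1 `SatisfiesUnitarity` (3D unitarity bounds `Δ ≥ 1/2` for `ℓ = 0`, `Δ ≥ ℓ + 1` for `ℓ ≥ 1`,
  `𝒪⁺` of even spin — Bose symmetry of `σ×σ`, Kos–Poland–Simmons-Duffin 2014 §3.2 — and real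
  OPE coefficients, which is the only form of positivity used: the `2×2` coefficient matrices
  are rank-one PSD) and `HasConvergentWeights` (retyped after REFEREE F39: diagonal OPE convergence
  `∑ λ² g(x,x) < ∞` at every `x ∈ (0,1)` for `⟨σσσσ⟩`, `⟨εεεε⟩`, `⟨εσσε⟩` — the
  Pappadopulo–Rychkov–Espin–Rattazzi convergence of the conformal block decomposition of a
  reflection-positive four-point function on the real segment `0 < z = z̄ < 1`, §4.1/§5.1; it is what
  justifies applying a derivative functional termwise);
  A3 `SatisfiesCrossing` (the five sum rules of Kos–Poland–Simmons-Duffin 2014, eq. (3.10)–(3.12),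
  as `HasSum` identities at every real `z, z̄ ∈ (0,1)`, `u = z z̄`, `v = (1-z)(1-z̄)`, with
  `F^{ij,kl}_{±}(u,v) = v^{(Δ_k+Δ_j)/2} g(u,v) ± u^{(Δ_k+Δ_j)/2} g(v,u)` = `crossF`, written for the
  `c_ℓ = 1` blocks of A2: Kos–Poland–Simmons-Duffin's blocks are `(-1)^ℓ ×` a positive multiple of
  these, so their spin-parity sign `(-1)^ℓ` sits on the `⟨σεσε⟩` rule 3 here and NOT on rules 4–5 —
  ERRATUM 2026-08-19, see `SatisfiesCrossing`);
  A4 `OnlySigmaEpsilonRelevant` (every `ℤ₂`-odd scalar of `σ×ε` with `Δ < 3` is `σ` itself and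
  every `ℤ₂`-even scalar of `σ×σ`, `ε×ε` with `Δ < 3` is `ε`: the gap assumptions `Δ_σ' ≥ 3`,
  `Δ_ε' ≥ 3` of Kos–Poland–Simmons-Duffin 2014 §5.3 / Kos–Poland–Simmons-Duffin–Vichi 2016 §2.1,
  and nothing else — no twist gap, no `T'` gap, no parity, no stress tensor).
* `IsingEnclosure W R` (A5): every `SigmaEpsilonData` satisfying the axioms with `(Δ_σ, Δ_ε) ∈ W`
  has `(Δ_σ, Δ_ε) ∈ R`. The window `W` is essential: generalised free fields `σ = φ`, `ε = φ²`
  with `Δ_φ ≥ 1` satisfy A1–A4 (Fitzpatrick–Kaplan–Poland–Simmons-Duffin 2013, eq. (2.6);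
  Heemskerk–Penedones–Polchinski–Sully 2009) and the numerics leave a bulk allowed region at
  `Δ_σ ≳ 0.54` (Kos–Poland–Simmons-Duffin 2014, §5.3), so `W = univ` is false for the island.

Sources: F. A. Dolan, H. Osborn, Nucl. Phys. B 678 (2004) 491, §2 and *Conformal partial waves:
further mathematical results*, arXiv:1108.6194 (2011), §2 eqs. (2.5)–(2.22) (Casimir operator (2.8)–(2.10), (2.19)–(2.22),
`a = -Δ₁₂/2`, `b = Δ₃₄/2` (2.11), boundary behaviour and normalisation `c_ℓ` (2.14), (2.17)–(2.18)); M. Hogervorst, S. Rychkov,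
Phys. Rev. D 87 (2013) 106004, §2–4 (radial expansion, descendant structure, convergence);
F. Kos, D. Poland, D. Simmons-Duffin, JHEP 11 (2014) 109, §3.1–3.3 (the five sum rules, `V_±`,
the functional conditions), §4 (poles), §5.3 (gaps); F. Kos, D. Poland, D. Simmons-Duffin,
A. Vichi, JHEP 08 (2016) 036, §2.1; D. Pappadopulo, S. Rychkov, J. Espin, R. Rattazzi, Phys.
Rev. D 86 (2012) 105043, §3–4.

Mathlib/tree search: Mathlib has no conformal blocks, Casimir operator, crossing equation or
CFT data (`lean search 'conformalBlock|Casimir|crossing'`); the tree's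
`Literature.Probability.LatticeModels.ConformalBlocks` / `IsStandard` is the identical-scalar v0
hypothesis structure (normalisation + continuity only) and is deliberately NOT reused here —
`BootstrapIslandMeanField.lean` shows it can be tailored. `deriv`, `HasSum`, `Summable`, `tsum`,
`Real.rpow` (`x ^ (y : ℝ)`), `Nat.choose`, `Even` are Mathlib's.

Design choices / junk values. (1) Blocks are pinned only on the open square `(0,1)²`, the only
place the sum rules evaluate them; `deriv` is applied to functions that are real-analytic there,
so no junk derivative is ever compared. (2) `HasLeadingPart` prescribes only the pure-`z` coefficients `k_{m0}`, `m ≤ ℓ`.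
(3) `Real.rpow` junk values (`0 ^ y`) do not arise: `z, z̄, 1-z, 1-z̄ > 0` on the square. (4) The
identity block is `fun _ _ => 1` and satisfies the generic predicate `IsConformalBlock3DAbove 0 0 0 0`
(`isConformalBlock3DAbove_one`), so the predicate is not vacuous; `(Δ,ℓ) = (0,0)` is itself an
accidental-degeneracy point (`n = j = 1`: `g_{1,1}` has Casimir eigenvalue `0`), which is harmless
because the identity enters the sum rules explicitly as the block `1` and never through A2. (5) An operator at a pole of the
block (e.g. a spin-`ℓ ≥ 1` operator exactly at `Δ = ℓ + 1` in `σ×ε` with `Δ_σ ≠ Δ_ε`) has no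
function satisfying the predicate, so A2 forces it to be absent from the data — in agreement with
the Ward-identity decoupling of conserved currents from unequal scalars (Kos–Poland–Simmons-Duffin
2014, §4, pole family 3); such an operator is also excluded by every SDP pipeline through the
pole prefactor. (6) Nothing about OPE-coefficient symmetry `λ_{σσε} = λ_{σεσ}`, isolation of
`σ, ε`, or the `θ`-scan of Kos–Poland–Simmons-Duffin–Vichi 2016 is typed: those belong to an
OPE-coefficient enclosure, not to `(Δ_σ, Δ_ε)`. What is deliberately NOT here: existence or
uniqueness of blocks, termwise differentiation (REFEREE.md T4), any certificate, any value.
-/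

namespace Literature.MathematicalPhysics.QuantumFieldTheory.ConformalBootstrap3D

open Set

/-! ### Three-dimensional conformal blocks, characterised -/

/-- The 3D unitarity bound on the scaling dimension of a spin-`ℓ` primary: `1/2` for `ℓ = 0`,
`ℓ + 1` for `ℓ ≥ 1` (`Δ ≥ (d-2)/2`, resp. `Δ ≥ ℓ + d - 2`, at `d = 3`).
(Poland–Rychkov–Vichi, Rev. Mod. Phys. 91 (2019) 015002, §II.C eq. (19); Kos–Poland–Simmons-Duffin
2014, §3.3 "`Δ_ℓ^min` … the unitarity bound".) [cite: PolandRychkovVichi2019, §II.C eq. (19)] -/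
noncomputable def unitarityBound3D (ℓ : ℕ) : ℝ :=
  if ℓ = 0 then 1 / 2 else (ℓ : ℝ) + 1

/-- The quadratic-Casimir eigenvalue in the Dolan–Osborn normalisation,
`c_{λ₁λ₂} = λ₁(λ₁-1) + λ₂(λ₂-1-2ε) = ½[Δ(Δ-d) + ℓ(ℓ+d-2)]` with `λ₁ = (Δ+ℓ)/2`, `λ₂ = (Δ-ℓ)/2`,
`ε = (d-2)/2`, at `d = 3`: `½[Δ(Δ-3) + ℓ(ℓ+1)]`.
(Dolan–Osborn 2011, eq. (2.22); Dolan–Osborn 2004, eq. (2.6).) [cite: DolanOsborn2011, §2 eq. (2.22)] -/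
noncomputable def casimirEigenvalue3D (Δ : ℝ) (ℓ : ℕ) : ℝ :=
  (Δ * (Δ - 3) + (ℓ : ℝ) * ((ℓ : ℝ) + 1)) / 2

/-- The single-variable Dolan–Osborn operator
`D_x(a,b) f = x²(1-x) f'' - (a+b+1) x² f' - a b x f` (Dolan–Osborn 2011, eq. (2.20)), with
Mathlib's `deriv` (junk value `0` where `f` is not differentiable; only applied to real-analytic
functions below). [cite: DolanOsborn2011, §2 eq. (2.20)] -/
noncomputable def dolanOsbornD (a b : ℝ) (f : ℝ → ℝ) (x : ℝ) : ℝ :=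
  x ^ 2 * (1 - x) * deriv (deriv f) x - (a + b + 1) * x ^ 2 * deriv f x - a * b * x * f x

/-- The three-dimensional quadratic Casimir equation for a function `g(z, z̄)` at the point
`(z, z̄)`, multiplied through by `(z - z̄)` to avoid the quotient: with `a = -Δ₁₂/2`, `b = Δ₃₄/2`
and `2ε = d - 2 = 1`,
`(z - z̄) [D_z g + D_z̄ g - c g] + z z̄ [(1-z) ∂_z g - (1-z̄) ∂_z̄ g] = 0`,
`c = casimirEigenvalue3D Δ ℓ`. This is `Δ^{(ε)}(a,b) F = c_{λ₁λ₂} F` of Dolan–Osborn 2011,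
eqs. (2.19)–(2.22) (their `x, x̄` are `z, z̄`; `u, v` form (2.8)–(2.10)), at `ε = 1/2`; `a, b` as in their
eq. (2.11). [cite: DolanOsborn2011, §2 eqs. (2.10)–(2.11), (2.19)–(2.22)] -/
def CasimirEq3D (Δ₁₂ Δ₃₄ Δ : ℝ) (ℓ : ℕ) (g : ℝ → ℝ → ℝ) (z zb : ℝ) : Prop :=
  (z - zb) * (dolanOsbornD (-Δ₁₂ / 2) (Δ₃₄ / 2) (fun t => g t zb) z
        + dolanOsbornD (-Δ₁₂ / 2) (Δ₃₄ / 2) (fun t => g z t) zb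
        - casimirEigenvalue3D Δ ℓ * g z zb)
      + z * zb * ((1 - z) * deriv (fun t => g t zb) z - (1 - zb) * deriv (fun t => g z t) zb) = 0

/-- `K` is the double power series `∑_{m,n} k_{mn} z^m z̄^n`, absolutely convergent on the open
unit bidisk `|z|, |z̄| < 1` (where the `z`-expansion of a conformal block converges:
Hogervorst–Rychkov 2013, §2). [cite: HogervorstRychkov2013, §2] -/
def IsDoublePowerSeriesOn (k : ℕ × ℕ → ℝ) (K : ℝ → ℝ → ℝ) : Prop :=
  ∀ z zb : ℝ, |z| < 1 → |zb| < 1 →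
    Summable (fun p : ℕ × ℕ => |k p| * |z| ^ p.1 * |zb| ^ p.2) ∧
      K z zb = ∑' p : ℕ × ℕ, k p * z ^ p.1 * zb ^ p.2

/-- The Dolan–Osborn boundary condition on the series coefficients, in its iterated-limit form
"`F_{λ₁λ₂}(x, x̄) → c_ℓ x^{λ₁} x̄^{λ₂}` as `x, x̄ → 0` with the limit `x̄ → 0` taken first"
(Dolan–Osborn 2011, eq. (2.9)), with `c_ℓ = 1`: the restriction `K(z, 0) = ∑_m k_{m0} z^m` is
`z^ℓ (1 + O(z))`, i.e. `k_{m0} = 0` for `m < ℓ` and `k_{ℓ0} = 1`. (Only the pure-`z` coefficients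
are prescribed; the mixed ones — the degree-`ℓ` part of `K` is the Legendre polynomial
`r^ℓ P_ℓ(η)` in `ρ, ρ̄`, not `(z+z̄)^ℓ` — are fixed by the Casimir equation.) The coefficient
`c_ℓ` is the same for every `(Δ₁₂, Δ₃₄)`; Kos–Poland–Simmons-Duffin 2014, §4 footnote 6, use
`c_ℓ = (-1)^ℓ 4^{-Δ} (ν)_ℓ/(2ν)_ℓ` instead, which differs by a factor depending on `(Δ, ℓ)` only —
a POSITIVE factor times `(-1)^ℓ`: the sign is not absorbed by squared OPE coefficients and is
carried explicitly by the crossing rules (A3, `SigmaEpsilonData.SatisfiesCrossing`, rule 3).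
[cite: DolanOsborn2011, §2 eqs. (2.14), (2.17)–(2.18)] -/
def HasLeadingPart (ℓ : ℕ) (k : ℕ × ℕ → ℝ) : Prop :=
  (∀ m : ℕ, m < ℓ → k (m, 0) = 0) ∧ k (ℓ, 0) = 1

/-- **Accidental degeneracy of the Casimir recursion.** `accidentalDegeneracy3D Δ ℓ` holds when
some pivot `C_{Δ+n,j} - C_{Δ,ℓ} = 2nΔ + n(n-3) + j(j+1) - ℓ(ℓ+1)` of the level-`n` recursion
(`n ≥ 1`, `0 ≤ j ≤ ℓ + n`, `j ≡ ℓ + n (mod 2)`: the descendant structure of Hogervorst–Rychkov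
2013, §4) vanishes — equivalently a second solution `(z z̄)^{(n+ℓ-j)/2} g_{Δ+n,j}` of the ansatz +
Casimir equation exists with vanishing boundary data, and `IsConformalBlock3DAbove` is NOT unique.
Per spin this is a finite set of rationals, all `≤ ℓ(ℓ+1)/2 + 1`, empty for `ℓ ≤ 2`; first members
`(Δ,ℓ) = (7,3), (11/2,4), (10,4), (15/2,5), (13,5), (16,5)` (exact-arithmetic enumeration and
explicit second solutions: pub-ising3d `code/check_block_predicate_B.py`, `verify_degeneracy.py`).
(Hogervorst–Rychkov 2013, §3–4: the recursion `(C_{Δ+n,j} - C_{Δ,ℓ}) B_{n,j} = …`.)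
[cite: HogervorstRychkov2013, §3–4] -/
def accidentalDegeneracy3D (Δ : ℝ) (ℓ : ℕ) : Prop :=
  ∃ n j : ℕ, 1 ≤ n ∧ j ≤ ℓ + n ∧ (j + ℓ + n) % 2 = 0 ∧
    2 * (n : ℝ) * Δ + (n : ℝ) * ((n : ℝ) - 3) + (j : ℝ) * ((j : ℝ) + 1) - (ℓ : ℝ) * ((ℓ : ℝ) + 1) = 0

/-- A parameter point is *regular* when it is neither the unitarity bound nor an accidental
degeneracy: there the generic predicate `IsConformalBlock3DAbove` is meant to pin the block
(uniqueness = REFEREE.md T1, not formalised). [folklore] -/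
def IsRegularPoint3D (Δ : ℝ) (ℓ : ℕ) : Prop :=
  Δ ≠ unitarityBound3D ℓ ∧ ¬ accidentalDegeneracy3D Δ ℓ

/-- **Genuine 3D scalar conformal block, generic case.** `IsConformalBlock3DAbove Δ₁₂ Δ₃₄ Δ ℓ g`
says that on the real square `z, z̄ ∈ (0,1)` the function `g` is `g^{Δ₁₂,Δ₃₄}_{Δ,ℓ}(z, z̄)`:
`g = (z z̄)^{(Δ-ℓ)/2} K` with `K` a symmetric double power series on the unit bidisk
(`IsDoublePowerSeriesOn`), with the Dolan–Osborn boundary condition `K(z,0) = z^ℓ(1 + O(z))`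
(`HasLeadingPart`, normalisation `c_ℓ = 1` uniformly in `Δ₁₂, Δ₃₄`), satisfying the quadratic
Casimir equation (`CasimirEq3D`) at every point of the square. The Casimir equation is triangular
in the total degree of `K` and determines `k_{mn}` uniquely from the boundary condition except at
the null-state poles `Δ = 1-ℓ-k`, `Δ = 3/2-k` (`k ≥ 1`), `Δ = ℓ+2-k` (`1 ≤ k ≤ ℓ`) of
Kos–Poland–Simmons-Duffin 2014, §4 Table 1, all `≤ unitarityBound3D ℓ`, AND except on the
accidental-degeneracy set `accidentalDegeneracy3D Δ ℓ` (where a vanishing pivot of the recursion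
admits the admixture of a second block with the same Casimir eigenvalue); for `Δ` strictly above
the bound and off that set the predicate is expected to have at most one solution (a theorem NOT
formalised here; checked symbolically against the closed forms in `d = 2, 4` for unequal external
dimensions, at `d = 3` against the diagonal `₃F₂` formula of Hogervorst–Osborn–Rychkov 2013 and
for the Legendre structure of the leading part, and the non-uniqueness on the degeneracy set
exhibited exactly — pub-ising3d `code/check_block_characterisation.py`, `code/check_block_predicate_B.py`).
AT the bound the predicate is degenerate (`Δ = ℓ+1`, `ℓ ≥ 1`, `Δ₁₂ = Δ₃₄ = 0`: the conserved-current
block is determined only up to the admixture of `(z z̄) g_{Δ+1,ℓ-1}`; `Δ₁₂ Δ₃₄ ≠ 0`: no solution;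
`Δ = 1/2`, `ℓ = 0`: no solution even for `Δ₁₂ = Δ₃₄ = 0`),
which is why `IsConformalBlock3D` below treats the bound by continuity from above.
(Dolan–Osborn 2011, §2 eqs. (2.5)–(2.22); Dolan–Osborn 2004, §2; Hogervorst–Rychkov 2013, §2–4.)
[cite: DolanOsborn2011, §2 eqs. (2.5)–(2.22)] -/
def IsConformalBlock3DAbove (Δ₁₂ Δ₃₄ Δ : ℝ) (ℓ : ℕ) (g : ℝ → ℝ → ℝ) : Prop :=
  ∃ (k : ℕ × ℕ → ℝ) (K : ℝ → ℝ → ℝ),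
    IsDoublePowerSeriesOn k K ∧ (∀ p : ℕ × ℕ, k (p.2, p.1) = k p) ∧ HasLeadingPart ℓ k ∧
      (∀ z zb : ℝ, z ∈ Ioo (0 : ℝ) 1 → zb ∈ Ioo (0 : ℝ) 1 →
        g z zb = (z * zb) ^ ((Δ - (ℓ : ℝ)) / 2) * K z zb) ∧
      ∀ z zb : ℝ, z ∈ Ioo (0 : ℝ) 1 → zb ∈ Ioo (0 : ℝ) 1 → CasimirEq3D Δ₁₂ Δ₃₄ Δ ℓ g z zb

/-- **Genuine 3D scalar conformal block.** At a regular point (`IsRegularPoint3D`),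
`IsConformalBlock3DAbove`; at the unitarity bound `Δ = unitarityBound3D ℓ` (conserved currents,
`ℓ ≥ 1`; the free-scalar point `ℓ = 0`, where the generic predicate has no solution — a free
scalar cannot appear in the OPE of two identical scalars, and the typed A2 excludes it as the
equation-of-motion Ward identity does) and on the accidental-degeneracy set, `g` is the pointwise
limit on the square of the blocks `g_{Δ',ℓ}` as `Δ' ↓ Δ` — the standard meromorphic-continuation
definition (Kos–Poland–Simmons-Duffin 2014, §4: the block is meromorphic in `Δ`, regular on the
degeneracy set, and the residue at a pole vanishes when the null state decouples, e.g.
`Δ₁₂ = Δ₃₄ = 0` for the family `Δ = ℓ+1`; when the residue does not vanish there is no limit and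
no function satisfies the predicate, so A2 forces such an operator to be absent, as unitarity
does). (Dolan–Osborn 2011, §2; Kos–Poland–Simmons-Duffin 2014, §4 eqs. (4.1)–(4.2).)
[cite: KosPolandSimmonsduffin2014, §4 eqs. (4.1)–(4.2)] -/
def IsConformalBlock3D (Δ₁₂ Δ₃₄ Δ : ℝ) (ℓ : ℕ) (g : ℝ → ℝ → ℝ) : Prop :=
  (IsRegularPoint3D Δ ℓ ∧ IsConformalBlock3DAbove Δ₁₂ Δ₃₄ Δ ℓ g) ∨
    (¬ IsRegularPoint3D Δ ℓ ∧ ∃ G : ℝ → ℝ → ℝ → ℝ,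
      (∀ Δ' ∈ Ioo Δ (Δ + 1), IsConformalBlock3DAbove Δ₁₂ Δ₃₄ Δ' ℓ (G Δ')) ∧
        ∀ z zb : ℝ, z ∈ Ioo (0 : ℝ) 1 → zb ∈ Ioo (0 : ℝ) 1 →
          Filter.Tendsto (fun Δ' => G Δ' z zb) (nhdsWithin Δ (Ioi Δ)) (nhds (g z zb)))

/-- The identity block `g_{0,0} ≡ 1` satisfies the generic predicate: `K ≡ 1` (`k = δ_{(0,0)}`),
boundary condition `k_{00} = 1`, Casimir equation with `a = b = 0`, `c = 0`, all derivatives of a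
constant `0`. (The point `(0,0)` is an accidental degeneracy, `n = j = 1`, so the generic
predicate is satisfied but not uniquely there; the sum rules use the identity explicitly, never
through A2.) (Dolan–Osborn 2011, §2 eqs. (2.14), (2.18): `c₀ = 1`; Poland–Rychkov–Vichi 2019, §III.A `g_{0,0} = 1`.)
[cite: DolanOsborn2011, §2 eqs. (2.14), (2.18)] -/
theorem isConformalBlock3DAbove_one : IsConformalBlock3DAbove 0 0 0 0 (fun _ _ => (1 : ℝ)) := by
  refine ⟨fun p => if p = (0, 0) then 1 else 0, fun _ _ => 1, ?_, ?_, ?_, ?_, ?_⟩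
  · intro z zb _ _
    refine ⟨?_, ?_⟩
    · refine summable_of_ne_finset_zero (s := {(0, 0)}) ?_
      intro p hp
      have : p ≠ (0, 0) := by simpa using hp
      simp [this]
    · rw [tsum_eq_single (0, 0)]
      · simp
      · intro p hp
        simp [hp]
  · intro p
    by_cases h : p = (0, 0)
    · subst h; simp
    · have h' : (p.2, p.1) ≠ (0, 0) := by
        intro h2
        apply h
        rw [Prod.ext_iff] at h2 ⊢
        exact ⟨h2.2, h2.1⟩
      simp [h, h']
  · exact ⟨fun m hm => absurd hm (Nat.not_lt_zero _), by simp⟩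
  · intro z zb hz hzb
    simp
  · intro z zb _ _
    simp [CasimirEq3D, dolanOsbornD, casimirEigenvalue3D]

/-! ### The σ–ε system: data and axioms -/

/-- The data of the `σ–ε` mixed-correlator bootstrap system (what the semidefinite programme of
Kos–Poland–Simmons-Duffin 2014, §3.2 sees). `ιp` indexes the `ℤ₂`-even non-identity primaries `𝒪⁺`
exchanged in `σ×σ` and `ε×ε` (dimension `Δp`, spin `ℓp`, real OPE coefficients `lamσσ`, `lamεε`, block
function `gp = g^{0,0}_{Δ,ℓ}`); `ιm` indexes the `ℤ₂`-odd primaries `𝒪⁻` exchanged in `σ×ε`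
(`Δm`, `ℓm`, `lamσε`, and the two block functions `gmm = g^{Δ_σε,Δ_σε}_{Δ,ℓ}` for `⟨σεσε⟩` and
`gpm = g^{-Δ_σε,Δ_σε}_{Δ,ℓ}` for `⟨εσσε⟩`, `Δ_σε = Δ_σ - Δ_ε`). The identity operator is not an
index: it enters the sum rules explicitly with `λ_{σσ𝟙} = λ_{εε𝟙} = 1` and block `1`
(Kos–Poland–Simmons-Duffin 2014, §3.2, text before eq. (3.13)). Hypothesis structure: the axioms
are the predicates below. [cite: KosPolandSimmonsduffin2014, §3.2] -/
structure SigmaEpsilonData where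
  /-- `Δ_σ`, the dimension of the `ℤ₂`-odd scalar `σ`. -/
  Δσ : ℝ
  /-- `Δ_ε`, the dimension of the `ℤ₂`-even scalar `ε`. -/
  Δε : ℝ
  /-- Index type of the `ℤ₂`-even non-identity primaries exchanged in `σ×σ`, `ε×ε`. -/
  ιp : Type
  /-- Dimensions of the `𝒪⁺`. -/
  Δp : ιp → ℝ
  /-- Spins of the `𝒪⁺`. -/
  ℓp : ιp → ℕ
  /-- OPE coefficients `λ_{σσ𝒪⁺}`. -/
  lamσσ : ιp → ℝ
  /-- OPE coefficients `λ_{εε𝒪⁺}`. -/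
  lamεε : ιp → ℝ
  /-- Block functions `g^{0,0}_{Δ,ℓ}(z, z̄)` of the `𝒪⁺`. -/
  gp : ιp → ℝ → ℝ → ℝ
  /-- Index type of the `ℤ₂`-odd primaries exchanged in `σ×ε`. -/
  ιm : Type
  /-- Dimensions of the `𝒪⁻`. -/
  Δm : ιm → ℝ
  /-- Spins of the `𝒪⁻`. -/
  ℓm : ιm → ℕ
  /-- OPE coefficients `λ_{σε𝒪⁻}`. -/
  lamσε : ιm → ℝ
  /-- Block functions `g^{Δ_σε,Δ_σε}_{Δ,ℓ}(z, z̄)` of the `𝒪⁻` (for `⟨σεσε⟩`). -/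
  gmm : ιm → ℝ → ℝ → ℝ
  /-- Block functions `g^{-Δ_σε,Δ_σε}_{Δ,ℓ}(z, z̄)` of the `𝒪⁻` (for `⟨εσσε⟩`). -/
  gpm : ιm → ℝ → ℝ → ℝ

namespace SigmaEpsilonData

/-- `Δ_σε = Δ_σ - Δ_ε`, the external-dimension difference entering the `⟨σεσε⟩`, `⟨εσσε⟩` blocks
(Kos–Poland–Simmons-Duffin 2014, §3.1: blocks depend on `Δ_ij`, `Δ_kl`). [cite: KosPolandSimmonsduffin2014, §3.1] -/
def Δσε (D : SigmaEpsilonData) : ℝ := D.Δσ - D.Δε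

/-- **A2 — genuine blocks.** Every block function of the data is the genuine 3D block with the
right parameters: `gp i = g^{0,0}_{Δp i, ℓp i}`, `gmm j = g^{Δ_σε,Δ_σε}_{Δm j, ℓm j}`,
`gpm j = g^{-Δ_σε,Δ_σε}_{Δm j, ℓm j}` (Kos–Poland–Simmons-Duffin 2014, §3.1 eq. (3.4) and §5.1).
[cite: KosPolandSimmonsduffin2014, §3.1 eq. (3.4)] -/
def HasGenuineBlocks (D : SigmaEpsilonData) : Prop :=
  (∀ i, IsConformalBlock3D 0 0 (D.Δp i) (D.ℓp i) (D.gp i)) ∧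
    (∀ j, IsConformalBlock3D D.Δσε D.Δσε (D.Δm j) (D.ℓm j) (D.gmm j)) ∧
      ∀ j, IsConformalBlock3D (-D.Δσε) D.Δσε (D.Δm j) (D.ℓm j) (D.gpm j)

/-- **A1 — unitarity (spectral part).** `Δ_σ, Δ_ε ≥ 1/2`; every exchanged primary obeys the 3D
unitarity bound; the `𝒪⁺` of `σ×σ`, `ε×ε` have even spin (Bose symmetry). Positivity of the OPE
data is built into the structure: the coefficients are real, so the `2×2` matrices
`(λ_{σσ𝒪}, λ_{εε𝒪})ᵀ(λ_{σσ𝒪}, λ_{εε𝒪})` are PSD and `λ_{σε𝒪}² ≥ 0` — exactly the positivity the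
SDP uses (Kos–Poland–Simmons-Duffin 2014, §3.2 eq. (3.12)–(3.13), §3.3 eq. (3.16)).
[cite: KosPolandSimmonsduffin2014, §3.2–3.3] -/
def SatisfiesUnitarity (D : SigmaEpsilonData) : Prop :=
  1 / 2 ≤ D.Δσ ∧ 1 / 2 ≤ D.Δε ∧
    (∀ i, unitarityBound3D (D.ℓp i) ≤ D.Δp i) ∧ (∀ i, Even (D.ℓp i)) ∧
      ∀ j, unitarityBound3D (D.ℓm j) ≤ D.Δm j

/-- **A1 — convergence clause (diagonal OPE convergence; retyped 2026-08-18, REFEREE F39).** At every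
real diagonal point `z = z̄ = x ∈ (0,1)` the conformal block expansions of the three reflection-positive
four-point functions converge with the squared OPE coefficients as weights:
`∑_{𝒪⁺} λ_{σσ𝒪}² g_𝒪(x,x) < ∞` (`⟨σσσσ⟩`), `∑_{𝒪⁺} λ_{εε𝒪}² g_𝒪(x,x) < ∞` (`⟨εεεε⟩`) and
`∑_{𝒪⁻} λ_{σε𝒪}² g^{-Δ_σε,Δ_σε}_𝒪(x,x) < ∞` (`⟨εσσε⟩`, the block family `gpm`, `a = b = Δ_σε/2`).
Source, verbatim (identical external scalars `φ`): "the conformal block decomposition converges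
exponentially fast for each `z` in the unit disc `r = |z| < 1`" and the defining series "is term-by-term
positive for real `0 < z < 1`, which corresponds to reflection positive point configurations"
(Pappadopulo–Rychkov–Espin–Rattazzi 2012, §5.1 and §5 before eq. (5.4)); the proof is the Hilbert-space
statement of §4.1, "the scalar product of two finite norm states converges", applied to
`⟨φ|φ(x₃)φ(x₂)|φ⟩` — for `⟨εσσε⟩` read `⟨ε|σ(x₃)σ(x₂)|ε⟩` (same argument; no separate printed statement
is claimed for the mixed correlator). This clause is STRONGER than the r0 clause `∑ λ² r^Δ < ∞ (r < 1)`
it replaces (for `𝒪⁺` above the unitarity bound and off the accidental degeneracies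
`g_𝒪(x,x) ≥ x^{Δ_𝒪}/λ_ℓ ≥ x^{Δ_𝒪}`, `BlockDiagonalEnclosure.IsConformalBlock3D.rpow_div_le_diag`), so
every enclosure statement over `SatisfiesBootstrapAxioms` only becomes easier, and nothing landed uses
the clause's body (REFEREE F29). It is the hypothesis under which a DERIVATIVE functional at
`z = z̄ = 1/2` acts termwise: with the bidisk domination `|g(z,z̄)| ≤ g(x_K,x_K)` it is a Weierstrass
M-test (REFEREE F39, lemma T4-A, not yet formalised); point-evaluation functionals need no convergence
clause at all (`DualFunctional`). No clause is imposed on the `a = -b` family `gmm` (`⟨σεσε⟩`, not a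
reflection-positive configuration on the diagonal). [cite: PappadopuloRychkovEspinRattazzi2012, §4.1, §5.1] -/
def HasConvergentWeights (D : SigmaEpsilonData) : Prop :=
  ∀ x : ℝ, 0 < x → x < 1 →
    Summable (fun i => D.lamσσ i ^ 2 * D.gp i x x) ∧
      Summable (fun i => D.lamεε i ^ 2 * D.gp i x x) ∧
        Summable (fun j => D.lamσε j ^ 2 * D.gpm j x x)

end SigmaEpsilonData

/-- The crossing combination `F^{ij,kl}_{±}` of a block in `z`-coordinates:
`crossF s sign g z z̄ = v^s g(z,z̄) + sign · u^s g(1-z, 1-z̄)` with `u = z z̄`, `v = (1-z)(1-z̄)`,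
`s = (Δ_k + Δ_j)/2`, `sign = -1` for `F_-` and `+1` for `F_+`; `g(v,u)` in the cross-ratio form is
`g(1-z, 1-z̄)`. (Kos–Poland–Simmons-Duffin 2014, §3.1 eq. (3.7).) [cite: KosPolandSimmonsduffin2014, §3.1 eq. (3.7)] -/
noncomputable def crossF (s sign : ℝ) (g : ℝ → ℝ → ℝ) (z zb : ℝ) : ℝ :=
  ((1 - z) * (1 - zb)) ^ s * g z zb + sign * (z * zb) ^ s * g (1 - z) (1 - zb)

namespace SigmaEpsilonData

/-- **A3 — crossing: the five sum rules**, at every real `z, z̄ ∈ (0,1)`, as `HasSum` identities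
(the identity operator written separately, `λ_{σσ𝟙} = λ_{εε𝟙} = 1`, block `1`). With
`s = (Δ_σ + Δ_ε)/2`:
1. `0 = F^{σσ,σσ}_-(𝟙) + ∑_{𝒪⁺} λ_{σσ𝒪}² F^{σσ,σσ}_{-,𝒪}` (prefactor exponent `Δ_σ`, block `g^{0,0}`);
2. `0 = F^{εε,εε}_-(𝟙) + ∑_{𝒪⁺} λ_{εε𝒪}² F^{εε,εε}_{-,𝒪}` (exponent `Δ_ε`);
3. `0 = ∑_{𝒪⁻} (-1)^ℓ λ_{σε𝒪}² F^{σε,σε}_{-,𝒪}` (exponent `s`, block `g^{Δ_σε,Δ_σε}` = `gmm`, no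
   identity);
4. `0 = F^{σσ,εε}_-(𝟙) + ∑_{𝒪⁺} λ_{σσ𝒪}λ_{εε𝒪} F^{σσ,εε}_{-,𝒪} + ∑_{𝒪⁻} λ_{σε𝒪}² F^{εσ,σε}_{-,𝒪}`
   (exponents `s` and `Δ_σ`; odd-sector block `g^{-Δ_σε,Δ_σε}` = `gpm`);
5. `0 = F^{σσ,εε}_+(𝟙) + ∑_{𝒪⁺} λ_{σσ𝒪}λ_{εε𝒪} F^{σσ,εε}_{+,𝒪} - ∑_{𝒪⁻} λ_{σε𝒪}² F^{εσ,σε}_{+,𝒪}`.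
In 4–5 the even and odd sums are required to converge separately (they do, absolutely, in any
unitary CFT on the square). These are eq. (3.10)–(3.13) and the vectors `V_{±,Δ,ℓ}` of
Kos–Poland–Simmons-Duffin 2014, §3.2, i.e. eq. (2.1) of Kos–Poland–Simmons-Duffin–Vichi 2016,
WRITTEN FOR THE `c_ℓ = 1` BLOCKS OF A2. Kos–Poland–Simmons-Duffin print the spin-parity sign
(`λ_{σε𝒪} = (-1)^ℓ λ_{εσ𝒪}`) as `(-1)^ℓ λ_{σε𝒪}²` on rules 4–5 and none on rule 3, for THEIR blocks
`g^{KPSD}_{Δ,ℓ} = (-1)^ℓ · κ_{Δ,ℓ} · g_{Δ,ℓ}`, `κ_{Δ,ℓ} > 0` (§4 footnote 6, `HasLeadingPart`; `g` = the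
block of A2, a non-negative double series at `Δ₁₂ = -Δ₃₄`): only the products `(coefficient) × (block)` are
convention-free, so for the blocks of A2 the factor `(-1)^ℓ` moves to rule 3 (block family
`a = -b`, the non-reflection-positive ordering `⟨σεσε⟩`) and disappears from rules 4–5 (family
`a = b`, the reflection-positive ordering `⟨εσσε⟩`, every odd-sector term entering with `+λ²`).
ERRATUM (2026-08-19): until this date the tree carried the verbatim placement, i.e. the vector
`(-1)^ℓ V_{-,Δ,ℓ}` — the wrong sign for every odd-spin `ℤ₂`-odd operator, not absorbable in `λ² ≥ 0`.
Checks of the corrected placement: two independent generalized free fields satisfy rules 3–5 as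
stated here (residuals `< 10⁻¹²`) and violate the verbatim transcription by `0.17–0.41` at
`(z, z̄) = (0.4, 0.3)` relative to an identity term `0.30`; the exact block decomposition of
`⟨εσσε⟩ = u^s v^{-Δ_σ}` has all coefficients `> 0` (spin 1: `Δ_σΔ_ε/(Δ_σ+Δ_ε)`) and that of
`⟨σεσε⟩ = u^s` the same numbers times `(-1)^ℓ`; and the unitarity-bound residue
`Res_{Δ→ℓ+1} V_{-,Δ,ℓ} = +|R| · V_{-,ℓ+2,ℓ-1}` is a positive multiple of the spin-`(ℓ-1)` vector only
with this placement (pub-ising3d A3-SIGN-ERRATUM.md, code/typer-g3/a3_sign_test.py). Rules 1–2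
and every single-correlator consequence are unaffected (even spins only).
[cite: KosPolandSimmonsduffin2014, §3.2 eqs. (3.10)–(3.13)] -/
def SatisfiesCrossing (D : SigmaEpsilonData) : Prop :=
  ∀ z zb : ℝ, z ∈ Ioo (0 : ℝ) 1 → zb ∈ Ioo (0 : ℝ) 1 →
    HasSum (fun i => D.lamσσ i ^ 2 * crossF D.Δσ (-1) (D.gp i) z zb)
        (-(crossF D.Δσ (-1) (fun _ _ => 1) z zb)) ∧
      HasSum (fun i => D.lamεε i ^ 2 * crossF D.Δε (-1) (D.gp i) z zb)
        (-(crossF D.Δε (-1) (fun _ _ => 1) z zb)) ∧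
      HasSum (fun j => (-1 : ℝ) ^ D.ℓm j * D.lamσε j ^ 2 *
          crossF ((D.Δσ + D.Δε) / 2) (-1) (D.gmm j) z zb) 0 ∧
      (∃ Sp Sm : ℝ,
        HasSum (fun i => D.lamσσ i * D.lamεε i * crossF ((D.Δσ + D.Δε) / 2) (-1) (D.gp i) z zb) Sp ∧
          HasSum (fun j => D.lamσε j ^ 2 * crossF D.Δσ (-1) (D.gpm j) z zb) Sm ∧
            crossF ((D.Δσ + D.Δε) / 2) (-1) (fun _ _ => 1) z zb + Sp + Sm = 0) ∧
      ∃ Sp Sm : ℝ,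
        HasSum (fun i => D.lamσσ i * D.lamεε i * crossF ((D.Δσ + D.Δε) / 2) 1 (D.gp i) z zb) Sp ∧
          HasSum (fun j => D.lamσε j ^ 2 * crossF D.Δσ 1 (D.gpm j) z zb) Sm ∧
            crossF ((D.Δσ + D.Δε) / 2) 1 (fun _ _ => 1) z zb + Sp - Sm = 0

/-- **A4 — gap assumptions, exactly those of the island numerics.** Every `ℤ₂`-odd scalar
exchanged in `σ×ε` with `Δ < 3` is `σ` itself (`Δ_σ' ≥ 3`), and every `ℤ₂`-even non-identity
scalar exchanged in `σ×σ`, `ε×ε` with `Δ < 3` is `ε` (`Δ_ε' ≥ 3`): "σ and ε are the only relevant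
scalar operators". No twist gap, spin-2 gap, parity or stress-tensor assumption is made.
(Kos–Poland–Simmons-Duffin 2014, §5.3; Kos–Poland–Simmons-Duffin–Vichi 2016, §2.1.)
[cite: KosPolandSimmonsduffin2014, §5.3] -/
def OnlySigmaEpsilonRelevant (D : SigmaEpsilonData) : Prop :=
  (∀ j, D.ℓm j = 0 → D.Δm j < 3 → D.Δm j = D.Δσ) ∧
    ∀ i, D.ℓp i = 0 → D.Δp i < 3 → D.Δp i = D.Δε

/-- **The typed bootstrap axioms A1–A4** of the `σ–ε` system: genuine blocks, unitarity bounds and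
even spins, convergent weights, the five crossing sum rules, and the gaps `Δ_σ', Δ_ε' ≥ 3`.
(Kos–Poland–Simmons-Duffin 2014, §3.2–3.3 and §5.3; Kos–Poland–Simmons-Duffin–Vichi 2016, §2.1.)
[cite: KosPolandSimmonsDuffinVichi2016, §2.1] -/
def SatisfiesBootstrapAxioms (D : SigmaEpsilonData) : Prop :=
  D.HasGenuineBlocks ∧ D.SatisfiesUnitarity ∧ D.HasConvergentWeights ∧ D.SatisfiesCrossing ∧
    D.OnlySigmaEpsilonRelevant

end SigmaEpsilonData

/-! ### The windowed enclosure statement -/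

/-- **A5 — windowed enclosure.** `IsingEnclosure W R`: every `σ–ε` bootstrap datum satisfying
`SatisfiesBootstrapAxioms` whose `(Δ_σ, Δ_ε)` lies in the window `W` has `(Δ_σ, Δ_ε) ∈ R`. The
window is essential (generalised free fields with `Δ_φ ≥ 1` satisfy A1–A4 at `Δ_σ = Δ_φ ≥ 1`;
the numerics leave a bulk allowed region at `Δ_σ ≳ 0.54`: Kos–Poland–Simmons-Duffin 2014, §5.3).
The printed island `Δ_σ = 0.5181489(10)`, `Δ_ε = 1.412625(10)` (Kos–Poland–Simmons-Duffin–Vichi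
2016, §1) is a floating-point SDPB result, not an instance of this predicate; a certified instance
is what a rational dual-functional certificate proves, box by box. [cite: KosPolandSimmonsduffin2014, §5.3] -/
def IsingEnclosure (W R : Set (ℝ × ℝ)) : Prop :=
  ∀ D : SigmaEpsilonData, D.SatisfiesBootstrapAxioms → (D.Δσ, D.Δε) ∈ W → (D.Δσ, D.Δε) ∈ R

/-- Monotonicity: a smaller window and a larger region. Elementary. [folklore] -/
theorem IsingEnclosure.mono {W W' R R' : Set (ℝ × ℝ)} (h : IsingEnclosure W R) (hW : W' ⊆ W)
    (hR : R ⊆ R') : IsingEnclosure W' R' :=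
  fun D hD hmem => hR (h D hD (hW hmem))

/-- Two enclosures on the same window intersect. Elementary. [folklore] -/
theorem IsingEnclosure.inter {W R₁ R₂ : Set (ℝ × ℝ)} (h₁ : IsingEnclosure W R₁)
    (h₂ : IsingEnclosure W R₂) : IsingEnclosure W (R₁ ∩ R₂) :=
  fun D hD hmem => ⟨h₁ D hD hmem, h₂ D hD hmem⟩

/-- Enclosures glue along a union of windows (the cover `W \ R = ⋃ Qᵢ` of certified boxes).
Elementary. [folklore] -/
theorem IsingEnclosure.union {W₁ W₂ R : Set (ℝ × ℝ)} (h₁ : IsingEnclosure W₁ R)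
    (h₂ : IsingEnclosure W₂ R) : IsingEnclosure (W₁ ∪ W₂) R :=
  fun D hD hmem => hmem.elim (h₁ D hD) (h₂ D hD)

/-- A box `Q` is *excluded* if no datum satisfying the axioms has `(Δ_σ, Δ_ε) ∈ Q`; equivalently
`IsingEnclosure Q ∅`. This is the content of one certified dual functional (Kos–Poland–
Simmons-Duffin 2014, §3.3 eq. (3.16): the functional is positive on the identity and on every
exchanged operator, contradicting the sum rules). [cite: KosPolandSimmonsduffin2014, §3.3 eq. (3.16)] -/
def BoxExcluded (Q : Set (ℝ × ℝ)) : Prop :=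
  ∀ D : SigmaEpsilonData, D.SatisfiesBootstrapAxioms → (D.Δσ, D.Δε) ∉ Q

/-- An excluded box is an enclosure with empty region. Elementary. [folklore] -/
theorem BoxExcluded.isingEnclosure {Q : Set (ℝ × ℝ)} (h : BoxExcluded Q) : IsingEnclosure Q ∅ :=
  fun D hD hmem => (h D hD hmem).elim

/-- Assembly of a certificate: if `W ⊆ R ∪ ⋃ᵢ Qᵢ` and every `Qᵢ` is excluded, then
`IsingEnclosure W R`. Elementary. [folklore] -/
theorem isingEnclosure_of_cover {ι : Type*} {W R : Set (ℝ × ℝ)} (Q : ι → Set (ℝ × ℝ))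
    (hcov : W ⊆ R ∪ ⋃ i, Q i) (hQ : ∀ i, BoxExcluded (Q i)) : IsingEnclosure W R := by
  intro D hD hmem
  rcases hcov hmem with hR | hQ'
  · exact hR
  · obtain ⟨i, hi⟩ := Set.mem_iUnion.mp hQ'
    exact ((hQ i) D hD hi).elim

end Literature.MathematicalPhysics.QuantumFieldTheory.ConformalBootstrap3D
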